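import Summits.CriticalPhenomena.CardyFormulaZ2.Theorems.CardySelfRefinementLagHandOffColumnEscapeCells
import HarnessLib

/-!
# Escape walks of faces crossing no edge of `Ω_δ`, II: trapped cells lie in `closure Ω`
(groundwork for stub `stub_tournamentTransfer`, line `hitting-tournament`, crux `LagHandOff`,
stmt-CriticalPhenomena-10268; registered sub-goal stub `stub_tournamentTransfer_escapeExterior`)

Second file of the series proving the escape hypothesis of `medialExploration_first_column_iff`
(see `…ColumnEscapeCells.lean`).  For discrete Dobrushin data `E` on the carrier of a Jordan
domain, positive mesh, and a face `g` whose set `R` of faces reached by the escape relation of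
`Ω_δ` (`fun a b => (zdGraph 2).Adj a b ∧ sepEdge a b ∉ (discreteDomainGraph E.Ω E.δ).edgeSet`)
is finite:

* `disjoint_cell_exterior_esc` — no open cell of a face of `R` meets the exterior
  `V = (closure Ω)ᶜ`.  Last-exit argument adapted from `disjoint_cell_exterior`
  (`InnerFacesHoleFree.lean`): `V` is open, connected, unbounded with frontier `∂Ω` (Jordan
  curve theorem, `JordanDomain.exterior_of_JCT`); a path in `V` from a point of such a cell to a
  point of `V` off the union `K` of the closed cells of `R` has a last time in `K`; the point
  `z ∈ V` then reached is in an open cell of `R`, on an open side, or at a vertex.  Open cells,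
  open rectangles across a side between two `R`-cells and open squares around a vertex all of
  whose cells are in `R` are open in `K` (impossible); a side towards a non-`R` face is an EDGE
  OF `Ω_δ` (else crossing it is an escape step and the face is in `R`), whose segment lies in
  `closure Ω ⊆ Vᶜ`; at a vertex with a non-`R` cell two consecutive cells around it are in / not
  in `R`, the edge between them is an edge of `Ω_δ` at the vertex, which is then a site of
  `Ω_δ` with mesh point in `Ω ⊆ Vᶜ`;
* `closure_cell_subset_esc` — hence the closed cells of `R` lie in `closure Ω`.

References: S. Smirnov, Ann. of Math. 172 (2010), §3 ("connected and simply connected"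
lattice domains); S. Smirnov, C. R. Acad. Sci. Paris 333 (2001), §2 (`Ω_δ`, the largest
component); G. Grimmett, *Percolation* (1999), §11.2 (planar duality); N. Holden, X. Sun,
arXiv:1905.13207, Prop. 6.25 (the dictionary this serves); the Jordan curve theorem of the tree
(`JordanCurveTheorem_holds`, `JordanDomain.exterior_of_JCT`).
-/

noncomputable section

open Set Metric Complex SimpleGraph
open Literature.Probability.Percolation Literature.Probability.LatticeModels
open Literature.Probability.LatticeModels.Mesh Literature.Probability.RandomPlanarGeometry

namespace Summit.CriticalPhenomena.CardyFormulaZ2.Cruxes.LagHandOff.HittingTournament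

/-! ### No open cell of a trapped face meets the exterior of the Jordan domain -/

section Exterior

variable {E : DiscreteDobrushin} (D : JordanDomain) (hΩ : E.Ω = D.carrier) (hδ : 0 < E.δ)
  {g : Site 2}

include hΩ hδ

/-- **No open cell of a face reached from `g` meets the exterior**, if the reached set is
finite.  Last-exit argument (adapted from `disjoint_cell_exterior` of
`InnerFacesHoleFree.lean`): a path in the open connected unbounded exterior
`V = (closure Ω)ᶜ` (Jordan curve theorem) from a point of such a cell to a point of `V` off the
union `K` of the closed reached cells has a last time in `K`; the point `z ∈ V` then reached lies
in an open cell of a reached face, on an open side between two cells or at a vertex.  Open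
cells, open rectangles across a side between two reached cells and open squares around a vertex
all of whose cells are reached are open subsets of `K` (impossible after the last time); a side
towards a non-reached face is an edge of `Ω_δ` (else the step across it is an escape step),
whose segment lies in `closure Ω ⊆ Vᶜ`; at a vertex with a non-reached cell, two consecutive
cells around it are reached / not reached, the edge between them is an edge of `Ω_δ`, so the
vertex is a site of `Ω_δ` and its mesh point lies in `Ω ⊆ Vᶜ`. [folklore] -/
theorem disjoint_cell_exterior_esc (hRfin : {r | Relation.ReflTransGen (fun a b : Site 2 => (zdGraph 2).Adj a b ∧ sepEdge a b ∉ (discreteDomainGraph E.Ω E.δ).edgeSet) g r}.Finite)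
    {r : Site 2} (hr : Relation.ReflTransGen (fun a b : Site 2 => (zdGraph 2).Adj a b ∧ sepEdge a b ∉ (discreteDomainGraph E.Ω E.δ).edgeSet) g r) :
    Disjoint (cell E.δ (r 0) (r 1)) (closure D.carrier)ᶜ := by
  classical
  -- adapted from `Literature.Probability.LatticeModels.disjoint_cell_exterior`
  set G := discreteDomainGraph E.Ω E.δ with hG
  set R : Set (Site 2) := {r | Relation.ReflTransGen (fun a b : Site 2 => (zdGraph 2).Adj a b ∧ sepEdge a b ∉ (discreteDomainGraph E.Ω E.δ).edgeSet) g r} with hR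
  set δ := E.δ with hδdef
  obtain ⟨hVconn, hVfr, hVunb⟩ :=
    D.exterior_of_JCT Literature.Topology.PlaneTopology.JordanCurveTheorem_holds
  set V : Set ℂ := (closure D.carrier)ᶜ with hV
  have hVopen : IsOpen V := isClosed_closure.isOpen_compl
  have hΩcl : closure E.Ω = closure D.carrier := by rw [hΩ]
  rw [Set.disjoint_left]
  intro x hx hxV
  -- the union of closed cells of `R`
  set K := cellUnion δ R with hK
  have hKcl : IsClosed K := isClosed_cellUnion δ hRfin
  have hKbdd : Bornology.IsBounded K := isBounded_cellUnion hδ hRfin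
  have hrK : ∀ r' ∈ R, closure (cell δ (r' 0) (r' 1)) ⊆ K := fun r' hr' =>
    closure_cell_subset_cellUnion hr'
  -- a point of `V` outside `K`
  obtain ⟨ρ, hρ⟩ := hKbdd.subset_closedBall 0
  obtain ⟨w, hwV, hwK⟩ : ∃ w ∈ V, w ∉ K := by
    by_contra hall
    push Not at hall
    exact hVunb ((Metric.isBounded_closedBall (x := (0 : ℂ)) (r := ρ)).subset
      fun w hw => hρ (hall w hw))
  -- a path in `V` from `x` to `w`, and its last time in `K`
  have hpc : IsPathConnected V := (hVopen.isConnected_iff_isPathConnected).1 hVconn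
  obtain ⟨γ, hγV⟩ := hpc.joinedIn x hxV w hwV
  set T : Set ℝ := Icc (0 : ℝ) 1 ∩ γ.extend ⁻¹' K with hT
  have hTcl : IsClosed T := isClosed_Icc.inter (hKcl.preimage γ.continuous_extend)
  have h0T : (0 : ℝ) ∈ T := by
    refine ⟨⟨le_rfl, zero_le_one⟩, ?_⟩
    show γ.extend 0 ∈ K
    rw [γ.extend_zero]
    exact hrK r hr (subset_closure hx)
  have hTbdd : BddAbove T := ⟨1, fun t ht => ht.1.2⟩
  set t₀ := sSup T with ht₀
  have ht₀T : t₀ ∈ T := hTcl.csSup_mem ⟨0, h0T⟩ hTbdd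
  have ht₀le : t₀ ≤ 1 := ht₀T.1.2
  have ht₀K : γ.extend t₀ ∈ K := ht₀T.2
  have ht₀lt : t₀ < 1 := by
    rcases ht₀le.lt_or_eq with h | h
    · exact h
    · exfalso; rw [h, γ.extend_one] at ht₀K; exact hwK ht₀K
  set z := γ.extend t₀ with hz
  have hzV : z ∈ V := by rw [hz, γ.extend_apply ht₀T.1]; exact hγV _
  -- no open neighbourhood of `z` lies in `K`
  have key : ∀ U : Set ℂ, IsOpen U → z ∈ U → U ⊆ K → False := by
    intro U hU hzU hUK
    obtain ⟨t', ht', ht'1, ht'U⟩ := exists_gt_mem_of_continuous γ.continuous_extend ht₀lt hU hzU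
    have ht'T : t' ∈ T := ⟨⟨ht₀T.1.1.trans ht'.le, ht'1⟩, hUK ht'U⟩
    exact absurd (le_csSup hTbdd ht'T) (not_le.2 ht')
  have hzΩ : z ∉ closure E.Ω := by rw [hΩcl]; exact hzV
  -- `z` lies in a closed cell of `R`
  obtain ⟨r', hr'R, hzr'⟩ : ∃ r' ∈ R, z ∈ closure (cell δ (r' 0) (r' 1)) := by
    simpa only [hK, cellUnion, Set.mem_iUnion, exists_prop] using ht₀K
  -- closure property of `R`: a side towards a non-reached face is an edge of `Ω_δ`
  have hcl : ∀ {a b : Site 2}, a ∈ R → (zdGraph 2).Adj a b → b ∉ R → sepEdge a b ∈ G.edgeSet := by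
    intro a b ha hab hb
    by_contra hne
    exact hb (Relation.ReflTransGen.tail ha ⟨hab, hne⟩)
  set k := r' 0 with hk
  set j := r' 1 with hj
  rw [closure_cell hδ, mem_reProdIm] at hzr'
  obtain ⟨hre, him⟩ := hzr'
  have hδk : δ * k < δ * (k + 1) := by nlinarith
  have hδj : δ * j < δ * (j + 1) := by nlinarith
  by_cases hreo : z.re ∈ Ioo (δ * k) (δ * (k + 1))
  · by_cases himo : z.im ∈ Ioo (δ * j) (δ * (j + 1))
    · -- in the open cell
      exact key _ (isOpen_cell δ k j) ⟨hreo, himo⟩ ((subset_closure).trans (hrK r' hr'R))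
    · -- on a horizontal open side: `z.im = δ j₀`, `j₀ ∈ {j, j + 1}`
      obtain ⟨j₀, hj₀, hlow, hup⟩ : ∃ j₀ : ℤ, z.im = δ * j₀ ∧
          ((![k, j₀ - 1] : Site 2) ∈ R ∨ (![k, j₀] : Site 2) ∈ R) ∧
          (zdGraph 2).Adj (![k, j₀ - 1] : Site 2) ![k, j₀] := by
        have hr'eq : r' = ![k, j] := funext fun i => by fin_cases i <;> simp [hk, hj]
        have hadj : ∀ j₀ : ℤ, (zdGraph 2).Adj (![k, j₀ - 1] : Site 2) ![k, j₀] := fun j₀ => by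
          convert zdGraph_adj_add_cornerUnit (![k, j₀ - 1] : Site 2) 1 using 1
          exact funext fun i => by fin_cases i <;> simp
        rcases eq_or_eq_of_mem_Icc_of_not_mem_Ioo him himo with h | h
        · refine ⟨j, h, Or.inr ?_, hadj j⟩; rw [← hr'eq]; exact hr'R
        · refine ⟨j + 1, by rw [h]; push_cast; ring, Or.inl ?_, hadj (j + 1)⟩
          rw [show (j + 1 - 1 : ℤ) = j by ring, ← hr'eq]; exact hr'R
      have hzseg : z ∈ segment ℝ (meshPoint δ ![k, j₀]) (meshPoint δ ![k + 1, j₀]) := by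
        rw [meshPoint_vec, meshPoint_vec]; push_cast
        exact mem_segment_of_im_eq hδk hre hj₀
      -- if both faces are in `R`, an open rectangle around `z` lies in `K`
      by_cases hboth : (![k, j₀ - 1] : Site 2) ∈ R ∧ (![k, j₀] : Site 2) ∈ R
      · refine key _ (isOpen_Ioo.reProdIm isOpen_Ioo) ?_
          ((rect_subset_closure_cells_h hδ k j₀).trans ?_)
        · rw [mem_reProdIm]; refine ⟨hreo, ?_, ?_⟩ <;> rw [hj₀] <;> nlinarith
        · refine Set.union_subset ?_ ?_
          · have := hrK _ hboth.1; simpa using this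
          · have := hrK _ hboth.2; simpa using this
      · -- otherwise the side between them is an edge of `Ω_δ`, and `z` lies on it
        have hedge : sepEdge (![k, j₀ - 1] : Site 2) ![k, j₀] ∈ G.edgeSet := by
          rcases hlow with h | h
          · exact hcl h hup (fun h' => hboth ⟨h, h'⟩)
          · rw [sepEdge_comm]; exact hcl h hup.symm (fun h' => hboth ⟨h', h⟩)
        rw [sepEdge_vec_above] at hedge
        exact hzΩ ((meshGraph_adj_iff.1 (discreteDomainGraph_le_meshGraph _ _
          ((mem_edgeSet _).1 hedge))).2 hzseg)
  · -- `z.re = δ k₀`, `k₀ ∈ {k, k + 1}`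
    obtain ⟨k₀, hk₀, hk₀'⟩ : ∃ k₀ : ℤ, z.re = δ * k₀ ∧ (k₀ = k ∨ k₀ = k + 1) := by
      rcases eq_or_eq_of_mem_Icc_of_not_mem_Ioo hre hreo with h | h
      · exact ⟨k, h, Or.inl rfl⟩
      · exact ⟨k + 1, by rw [h]; push_cast; ring, Or.inr rfl⟩
    by_cases himo : z.im ∈ Ioo (δ * j) (δ * (j + 1))
    · -- on a vertical open side between `![k₀ - 1, j]` and `![k₀, j]`
      have hlow : (![k₀ - 1, j] : Site 2) ∈ R ∨ (![k₀, j] : Site 2) ∈ R := by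
        have hr'eq : r' = ![k, j] := funext fun i => by fin_cases i <;> simp [hk, hj]
        rcases hk₀' with rfl | rfl
        · right; rw [← hr'eq]; exact hr'R
        · left; rw [show (k + 1 - 1 : ℤ) = k by ring, ← hr'eq]; exact hr'R
      have hup : (zdGraph 2).Adj (![k₀ - 1, j] : Site 2) ![k₀, j] := by
        convert zdGraph_adj_add_cornerUnit (![k₀ - 1, j] : Site 2) 0 using 1
        exact funext fun i => by fin_cases i <;> simp
      have hzseg : z ∈ segment ℝ (meshPoint δ ![k₀, j]) (meshPoint δ ![k₀, j + 1]) := by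
        rw [meshPoint_vec, meshPoint_vec]; push_cast
        exact mem_segment_of_re_eq hδj him hk₀
      by_cases hboth : (![k₀ - 1, j] : Site 2) ∈ R ∧ (![k₀, j] : Site 2) ∈ R
      · refine key _ (isOpen_Ioo.reProdIm isOpen_Ioo) ?_
          ((rect_subset_closure_cells_v hδ k₀ j).trans ?_)
        · rw [mem_reProdIm]; refine ⟨⟨?_, ?_⟩, himo⟩ <;> rw [hk₀] <;> nlinarith
        · refine Set.union_subset ?_ ?_
          · have := hrK _ hboth.1; simpa using this
          · have := hrK _ hboth.2; simpa using this
      · have hedge : sepEdge (![k₀ - 1, j] : Site 2) ![k₀, j] ∈ G.edgeSet := by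
          rcases hlow with h | h
          · exact hcl h hup (fun h' => hboth ⟨h, h'⟩)
          · rw [sepEdge_comm]; exact hcl h hup.symm (fun h' => hboth ⟨h', h⟩)
        rw [sepEdge_vec_right] at hedge
        exact hzΩ ((meshGraph_adj_iff.1 (discreteDomainGraph_le_meshGraph _ _
          ((mem_edgeSet _).1 hedge))).2 hzseg)
    · -- at a vertex `v = ![k₀, j₀]`
      obtain ⟨j₀, hj₀, hj₀'⟩ : ∃ j₀ : ℤ, z.im = δ * j₀ ∧ (j₀ = j ∨ j₀ = j + 1) := by
        rcases eq_or_eq_of_mem_Icc_of_not_mem_Ioo him himo with h | h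
        · exact ⟨j, h, Or.inl rfl⟩
        · exact ⟨j + 1, by rw [h]; push_cast; ring, Or.inr rfl⟩
      set v : Site 2 := ![k₀, j₀] with hv
      have hzv : z = meshPoint δ v := by rw [hv, meshPoint_vec]; exact Complex.ext hk₀ hj₀
      have hr'c : IsCorner v r' := by
        refine isCorner_of_coords ?_ ?_
        · simp only [hv, Matrix.cons_val_zero]; rcases hk₀' with h | h <;> omega
        · simp only [hv, Matrix.cons_val_one, Matrix.cons_val_zero]; rcases hj₀' with h | h <;> omega
      obtain ⟨i₀, hi₀⟩ := exists_faceAt_of_isCorner hr'c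
      by_cases hall : ∀ i : Fin 4, faceAt v i ∈ R
      · -- the open square around `v` lies in `K`
        refine key _ (isOpen_Ioo.reProdIm isOpen_Ioo) ?_
          ((square_subset_closure_cells hδ k₀ j₀).trans ?_)
        · rw [mem_reProdIm]; refine ⟨⟨?_, ?_⟩, ?_, ?_⟩ <;> simp only [hk₀, hj₀] <;> nlinarith
        · have h0 := hrK _ (hall 0); have h1 := hrK _ (hall 1)
          have h2 := hrK _ (hall 2); have h3 := hrK _ (hall 3)
          simp only [faceAt, hv, cornerOff, Pi.sub_apply, Matrix.cons_val_zero,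
            Matrix.cons_val_one, Pi.add_apply, Pi.single_eq_same,
            Pi.single_eq_of_ne (show (1 : Fin 2) ≠ 0 by decide),
            Pi.single_eq_of_ne (show (0 : Fin 2) ≠ 1 by decide), sub_zero,
            Pi.zero_apply] at h0 h1 h2 h3
          refine Set.union_subset (Set.union_subset ?_ ?_) (Set.union_subset ?_ ?_)
          · simpa using h2
          · simpa using h3
          · simpa using h1
          · simpa using h0
      · -- some cell around `v` is not reached: after a reached one comes a non-reached one,
        -- the edge between them is an edge of `Ω_δ` at `v`, so `δ v ∈ Ω`
        push Not at hall
        have hstep : ∃ i : Fin 4, faceAt v i ∈ R ∧ faceAt v (i + 1) ∉ R := by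
          by_contra hno
          push Not at hno
          obtain ⟨i₁, hi₁⟩ := hall
          have h0 : faceAt v i₀ ∈ R := hi₀ ▸ hr'R
          have h1 := hno _ h0
          have h2 := hno _ h1
          have h3 := hno _ h2
          have : i₁ = i₀ ∨ i₁ = i₀ + 1 ∨ i₁ = i₀ + 1 + 1 ∨ i₁ = i₀ + 1 + 1 + 1 := by omega
          rcases this with rfl | rfl | rfl | rfl
          · exact hi₁ h0
          · exact hi₁ h1
          · exact hi₁ h2
          · exact hi₁ h3
        obtain ⟨i, hiR, hiR'⟩ := hstep
        have hedge : sepEdge (faceAt v i) (faceAt v (i + 1)) ∈ G.edgeSet :=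
          hcl hiR (adj_faceAt_succ v i) hiR'
        rw [sepEdge_faceAt_succ] at hedge
        have hvΩ : meshPoint δ v ∈ E.Ω :=
          meshDomain_subset_meshVertices _ _ (discreteDomainGraph_adj_iff.1 ((mem_edgeSet _).1 hedge)).2.1
        exact hzΩ (hzv ▸ subset_closure hvΩ)

/-- Hence the closed cell of a reached face lies in `closure Ω`. [folklore] -/
theorem closure_cell_subset_esc (hRfin : {r | Relation.ReflTransGen (fun a b : Site 2 => (zdGraph 2).Adj a b ∧ sepEdge a b ∉ (discreteDomainGraph E.Ω E.δ).edgeSet) g r}.Finite)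
    {r : Site 2} (hr : Relation.ReflTransGen (fun a b : Site 2 => (zdGraph 2).Adj a b ∧ sepEdge a b ∉ (discreteDomainGraph E.Ω E.δ).edgeSet) g r) :
    closure (cell E.δ (r 0) (r 1)) ⊆ closure E.Ω := by
  rw [hΩ]
  refine (closure_mono fun x hx => ?_).trans (by rw [closure_closure])
  by_contra hxV
  exact Set.disjoint_left.1 (disjoint_cell_exterior_esc D hΩ hδ hRfin hr) hx hxV

end Exterior

/-- **Registered sub-goal stub `stub_tournamentTransfer_escapeExterior`** (tree vocabulary; =
`closure_cell_subset_esc`: the closed cells of a finite set of faces reached from `g` by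
side-steps crossing no edge of `Ω_δ` lie in `closure Ω`, for Jordan domains). [folklore] -/
theorem stub_tournamentTransfer_escapeExterior : ∀ (D : JordanDomain) (E : DiscreteDobrushin) (g r : Site 2), E.Ω = D.carrier → 0 < E.δ → {q : Site 2 | Relation.ReflTransGen (fun a b : Site 2 => (zdGraph 2).Adj a b ∧ sepEdge a b ∉ (discreteDomainGraph E.Ω E.δ).edgeSet) g q}.Finite → Relation.ReflTransGen (fun a b : Site 2 => (zdGraph 2).Adj a b ∧ sepEdge a b ∉ (discreteDomainGraph E.Ω E.δ).edgeSet) g r → closure (Literature.Probability.LatticeModels.Mesh.cell E.δ (r 0) (r 1)) ⊆ closure E.Ω :=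
  fun D _ _ _ hΩ hδ hRfin hr => closure_cell_subset_esc D hΩ hδ hRfin hr

end Summit.CriticalPhenomena.CardyFormulaZ2.Cruxes.LagHandOff.HittingTournament

end
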